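import Summits.Ventures.QEC.Thresholds.ToricCodePhenomenologicalThresholds
import Summits.Ventures.QEC.Thresholds.ToricCodePhenomenologicalDecay
import Literature.InformationTheory.QuantumCodes.ToricCodePhenomenologicalProof
import Literature.Probability.LatticeModels.IsingCriticalBetaCubic
import Literature.Probability.Percolation.SusceptibilityPathCounting
import Literature.Probability.RandomPlanarGeometry.SAWCountStepWords
import HarnessLib

/-!
# Toric-code threshold with NOISY syndrome measurement (phenomenological model, `q = p`) — the
# UNCONDITIONAL theorems of the Dennis–Kitaev–Landahl–Preskill route (LADDER-QEC Q5, certified column)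

Venture QEC, `Summits/Ventures/QEC/Thresholds/` (the phenomenological twin of
`ToricCodeThresholdUnconditional.lean`). HONEST FRAMING: the instance file
`ToricCodePhenomenologicalThresholds.lean` (qec-type-09) and the DKLP-route decay theorem of
`ToricCodePhenomenologicalDecay.lean` took as explicit hypotheses the named facts
`ToricCode.phenomThreshold_of_sawCountBound` resp. `ToricCode.phenomFailureProb_le_of_sawCountBound`
of `Literature/…/ToricCodePhenomenological.lean`. Both facts are now PROVED in the tree
(`ToricCode.phenomThreshold_of_sawCountBound_holds`, `ToricCode.phenomFailureProb_le_of_sawCountBound_holds`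
in `Literature/…/ToricCodePhenomenologicalProof.lean`, on the space-time self-avoiding-polygon files
`SpaceTimePolygons.lean` / `SpaceTimePolygonExtraction.lean`), so this file discharges the
hypotheses BY IMPORT and records the resulting theorems WITHOUT any named-fact hypothesis and
without `native_decide` (axioms `propext`, `Classical.choice`, `Quot.sound` only):

| theorem | statement | walk-count input | value |
|---|---|---|---|
| `phenomThreshold_sawCountBound3` | `cₙ(ℤ³) ≤ C νⁿ` (`ν ≥ 1`) ⟹ `p₀(ν)` is a threshold lower bound | parametric (DKLP) | `p₀(ν) = (1-√(1-ν⁻²))/2` |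
| `phenomThreshold_memFour` | threshold `≥ p₀(4.865) > .0106` (NEW best KERNEL value) | `card_memFourWords_three_le` (Fisher–Sykes memory-4 automaton of `ℤ³`, Perron certificate by `decide`) | `> .0106` |
| `phenomThreshold_connectiveConstant_three_le` | any proved `μ(ℤ³) ≤ μ'` ⟹ threshold `≥ p₀(μ')` | `SAW.Zd.tendsto_count_rpow 3` | `p₀(μ')` |
| `phenomThreshold_PT2000_of_fact` | threshold `≥ p₀(4.7387) > .0112` | CONDITIONAL on the named fact `SAW.Zd.PT2000_connectiveConstant_three_le` ONLY | `> .0112` |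
| `phenom_failureProb_le_five` | finite size: `Prob_fail ≤ (12/25) L²(T+1) (10s)^L/(1-10s)`, `s = √(p(1-p))`, `L ≥ 3` | DKLP eq. (fail_iso), `ν = 5` | — |
| `phenom_decaysExponentially_sawCountBound3'` / `_memFour` | exponential decay in `L` below `p₀(ν)` / `p₀(4.865)` | parametric (DKLP) / memory-4 | — |

for EVERY polynomially bounded schedule of rounds `T(L)` and EVERY family of minimum-weight
space-time decoders (`Decoder.IsMinWeight` w.r.t. `stSyn`, `stCycles`, `hammingNorm`), under
phenomenological noise with equal qubit- and measurement-error rates (`q = p`) and a perfect closing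
round; plus the same bounds for the accuracy threshold `p_c` and the canonical instance
(`T(L) = L + 1`, `Decoder.minWeight`) of the memory-4 value. The value `p₀(5) ≈ .0101` is
unconditional by two cluster-counting routes as well (`ToricCodePhenomenologicalCluster.lean`,
qec-type-09: `1/(4·10⁴)`; `ToricCodePhenomenologicalClusterBound.lean` /
`ToricCodePhenomenologicalElementary.lean`, qec-lit-2: `thresholdValue 5`) and is NOT restated here
— three independent kernel proofs of a phenomenological threshold; the memory-4 value `p₀(4.865) > .0106` is the best
KERNEL-only decimal (Fisher–Sykes three-class automaton of `ℤ³`, Perron certificate by `decide`,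
`Literature/Probability/LatticeModels/IsingCriticalBetaCubic.lean`). The CHECKED-native value `p₀(4.76) > .0111`
(`native_decide` walk count) is kept out of this file (axiom hygiene; see
`ToricCodePhenomenologicalNativeUnconditional.lean`). NOT A THEOREM ANYWHERE: DKLP's printed
`p, q < .0114` (numerical `μ₃ ≈ 4.684`, CLAIM). Theorem-only file (no definitions, no named facts);
no Monte Carlo number appears here (VALIDATED column = `bench/VALIDATED.tsv`).

## References

* [DennisEtAl2002] E. Dennis, A. Kitaev, A. Landahl, J. Preskill, *Topological quantum memory*,
  J. Math. Phys. 43 (2002) 4452–4505, arXiv:quant-ph/0110143, §5.2–5.3 eqs. (saw_L), (saw_d),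
  (saw_3), (threshold_iso), (fail_iso), (threshold_iso_num).
* [PonitzTittmann2000] A. Pönitz, P. Tittmann, Electron. J. Combin. 7 (2000) R21, Table 2
  (`d = 3`, `k = 14`: `μ ≤ 4.7387`).
* [BDGS2012] Bauerschmidt–Duminil-Copin–Goodman–Slade, *Lectures on self-avoiding walks*, §1.3
  eqs. (1.12)–(1.13).
* [MadrasSlade1993] N. Madras, G. Slade, *The Self-Avoiding Walk*, Birkhäuser 1993, §1.2
  ((1.2.11)–(1.2.14): walks with finite memory; the memory-4 rate `λ₄ = 4.8645…` for `ℤ³`).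
-/

noncomputable section

namespace Summit.Ventures.QEC.Thresholds

open Filter Topology Finset
open Literature.InformationTheory.QuantumCodes
open Literature.InformationTheory.QuantumCodes.ToricCode
open Literature.Probability.RandomPlanarGeometry

/-! ### The parametric theorem, unconditional -/

/-- **The D4″ parametric theorem, phenomenological version, UNCONDITIONAL**: if `cₙ(ℤ³) ≤ C νⁿ`
for all `n` (`ν ≥ 1`), then for every polynomially bounded schedule of rounds and every
minimum-weight space-time decoder family, `p₀(ν) = (1 - √(1 - ν⁻²))/2` is a lower bound on the
accuracy threshold of the toric code under phenomenological noise with `q = p`. No named-fact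
hypothesis (discharged by `ToricCode.phenomThreshold_of_sawCountBound_holds`).
[cite: DennisEtAl2002, §5.3 eqs. (threshold_iso), (threshold_iso_num)] -/
theorem phenomThreshold_sawCountBound3 {C ν : ℝ} (hν : 1 ≤ ν) (hc : SAWCountBound3 C ν)
    {T : ℕ → ℕ} (hT : IsPolyBounded T) {D : (L : ℕ) → STDecoder (L + 1) (T L)}
    (hD : ∀ L, (D L).IsMinWeight (stSyn (L + 1) (T L)) (stCycles (L + 1) (T L)) hammingNorm) :
    IsThresholdLowerBound (phenomFailureFamily T D) (thresholdValue ν) :=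
  phenom_isThresholdLowerBound_of_sawCountBound3 phenomThreshold_of_sawCountBound_holds hν hc hT hD

/-- Under `SAWCountBound3 C ν` (`ν ≥ 1`), the accuracy threshold of every minimum-weight space-time
decoder family (any polynomially bounded schedule) is at least `p₀(ν)` — UNCONDITIONAL.
[cite: DennisEtAl2002, §5.3 (lower bound on the accuracy threshold)] -/
theorem phenom_thresholdValue_le_accuracyThreshold_sawCountBound3 {C ν : ℝ} (hν : 1 ≤ ν)
    (hc : SAWCountBound3 C ν) {T : ℕ → ℕ} (hT : IsPolyBounded T)
    {D : (L : ℕ) → STDecoder (L + 1) (T L)}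
    (hD : ∀ L, (D L).IsMinWeight (stSyn (L + 1) (T L)) (stCycles (L + 1) (T L)) hammingNorm) :
    thresholdValue ν ≤ accuracyThreshold (phenomFailureFamily T D) :=
  phenom_thresholdValue_le_accuracyThreshold phenomThreshold_of_sawCountBound_holds hν hc hT hD

/-! ### Instance 1 (tier CERTIFIED, kernel, unconditional): `ν = 5` — the finite-size bound

The threshold value `p₀(5) ≈ .0101` itself, its `p_c` form and the canonical instance are ALREADY
unconditional in the tree by the cluster route (qec-lit-2 `ToricCodePhenomenologicalElementary.lean`:
`phenomThreshold_elementary_unconditional`, `ToricCode.phenomThreshold_stMinWeight_unconditional`,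
`phenom_accuracyThreshold_gt_0101`; qec-type-09 `ToricCodePhenomenologicalFive.lean`: decay and
`HasThreshold` forms) and are not restated here (one statement in the tree). -/

/-- **Finite-size bound, `ν = 5`, UNCONDITIONAL** (DKLP eq. (fail_iso) with the elementary count
`cₙ(ℤ³) ≤ (6/5)·5ⁿ`): for `L ≥ 3`, any number of rounds `T`, any minimum-weight space-time decoder and
`0 ≤ p ≤ 1/2` with `10 s < 1`, `s = √(p(1-p))`:
`Prob_fail ≤ 2 L²(T+1) (6/5) (10 s)^L / (5 (1 - 10 s))`. [cite: DennisEtAl2002, §5.3 eq. (fail_iso)] -/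
theorem phenom_failureProb_le_five (L T : ℕ) [NeZero L] (hL : 3 ≤ L) (D : STDecoder L T)
    (hD : D.IsMinWeight (stSyn L T) (stCycles L T) hammingNorm) {p : ℝ} (hp₀ : 0 ≤ p) (hp : p ≤ 1 / 2)
    (hs : 10 * Real.sqrt (p * (1 - p)) < 1) :
    phenomFailureProb L T D p p ≤
      2 * (L : ℝ) ^ 2 * ((T : ℝ) + 1) * (6 / 5) * (10 * Real.sqrt (p * (1 - p))) ^ L /
        (5 * (1 - 10 * Real.sqrt (p * (1 - p)))) := by
  have h := phenomFailureProb_le_of_sawCountBound_holds (6 / 5) 5 (by norm_num) sawCountBound3_five L T hL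
    D hD p hp₀ hp (by linarith)
  have he : (2 : ℝ) * 5 * Real.sqrt (p * (1 - p)) = 10 * Real.sqrt (p * (1 - p)) := by ring
  rw [he] at h
  exact h

/-! ### Instance 1b (tier CERTIFIED, kernel, unconditional): the memory-4 cubic count, `ν = 4.865`, `p₀ > .0106` -/

/-- The Fisher–Sykes memory-4 count of `ℤ³` in the hypothesis shape: `cₙ(ℤ³) ≤ 270 · 4.865ⁿ`
(self-avoiding walks are memory-4 walks, `sawWords_subset_memFourWords`; the tree's kernel Perron
certificate `card_memFourWords_three_le` for the three-class automaton with root `λ₄ = 4.8645…`).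
[cite: MadrasSlade1993, §1.2 ((1.2.11)–(1.2.14), walks with finite memory)] -/
theorem sawCountBound3_memFour : SAWCountBound3 270 (4865 / 1000) := by
  intro n
  have h1 : (SAW.Zd.count 3 n : ℝ) = ((Literature.Probability.Percolation.sawWords 3 n).card : ℝ) := by
    rw [SAW.Zd.card_sawWords_eq_count]
  have h2 : ((Literature.Probability.Percolation.sawWords 3 n).card : ℝ) ≤
      ((Literature.Probability.Percolation.memFourWords 3 n).card : ℝ) := by
    exact_mod_cast Finset.card_le_card (Literature.Probability.Percolation.sawWords_subset_memFourWords 3 n)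
  rw [h1]
  exact h2.trans (Literature.Probability.LatticeModels.card_memFourWords_three_le n)

/-- **Phenomenological toric threshold `≥ p₀(4.865) > .0106`, UNCONDITIONAL, tier CERTIFIED
(kernel)** — the best kernel-only value: for every polynomially bounded schedule and every
minimum-weight space-time decoder family, `p₀(4.865)` is a threshold lower bound (memory-4 cubic
walk count in place of the elementary `ν = 5`). [cite: DennisEtAl2002, §5.3 eqs. (saw_3), (threshold_iso)] -/
theorem phenomThreshold_memFour {T : ℕ → ℕ} (hT : IsPolyBounded T)
    {D : (L : ℕ) → STDecoder (L + 1) (T L)}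
    (hD : ∀ L, (D L).IsMinWeight (stSyn (L + 1) (T L)) (stCycles (L + 1) (T L)) hammingNorm) :
    IsThresholdLowerBound (phenomFailureFamily T D) (thresholdValue (4865 / 1000)) :=
  phenomThreshold_sawCountBound3 (by norm_num) sawCountBound3_memFour hT hD

/-- Decimal certificate: `.0106 < p₀(4.865) < .0107`. [cite: DennisEtAl2002, §5.3 eq. (threshold_iso_num)] -/
theorem thresholdValue_memFour_bounds :
    (0.0106 : ℝ) < thresholdValue (4865 / 1000) ∧ thresholdValue (4865 / 1000) < 0.0107 := by
  unfold thresholdValue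
  constructor
  · have : Real.sqrt (1 - 1 / ((4865 : ℝ) / 1000) ^ 2) < 0.9788 := by
      rw [Real.sqrt_lt' (by norm_num)]
      norm_num
    linarith
  · have : (0.9786 : ℝ) < Real.sqrt (1 - 1 / ((4865 : ℝ) / 1000) ^ 2) := by
      rw [Real.lt_sqrt (by norm_num)]
      norm_num
    linarith

/-- **`p_c > .0106`, UNCONDITIONAL, tier CERTIFIED (kernel)**, under phenomenological noise
(`q = p`) for every minimum-weight space-time decoder family and every polynomially bounded schedule.
[cite: DennisEtAl2002, §5.3 eq. (threshold_iso_num)] -/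
theorem phenom_accuracyThreshold_gt_0106 {T : ℕ → ℕ} (hT : IsPolyBounded T)
    {D : (L : ℕ) → STDecoder (L + 1) (T L)}
    (hD : ∀ L, (D L).IsMinWeight (stSyn (L + 1) (T L)) (stCycles (L + 1) (T L)) hammingNorm) :
    (0.0106 : ℝ) < accuracyThreshold (phenomFailureFamily T D) :=
  lt_of_lt_of_le thresholdValue_memFour_bounds.1
    (le_accuracyThreshold (phenomThreshold_memFour hT hD)
      ((thresholdValue_le_half _).trans (by norm_num)))

/-- The canonical instance, UNCONDITIONAL, tier CERTIFIED (kernel): `T(L) = L + 1` rounds and the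
canonical minimum-weight space-time decoders — `p_c > .0106`. [cite: DennisEtAl2002, §5.3 eq. (threshold_iso_num)] -/
theorem ToricCode.phenom_accuracyThreshold_stMinWeight_gt_0106 :
    (0.0106 : ℝ) < accuracyThreshold
      (phenomFailureFamily (fun L => L + 1)
        fun L => Decoder.minWeight (stSyn (L + 1) (L + 1)) hammingNorm) :=
  phenom_accuracyThreshold_gt_0106 isPolyBounded_succ
    fun L => ToricCode.isMinWeight_stMinWeight (L + 1) (L + 1)

/-- **Exponential decay below `p₀(4.865) > .0106`, UNCONDITIONAL, kernel** (memory-4 cubic count),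
for every polynomially bounded schedule and every minimum-weight space-time decoder family.
[cite: DennisEtAl2002, §5.3 eq. (fail_iso)] -/
theorem phenom_decaysExponentially_memFour {T : ℕ → ℕ} (hT : IsPolyBounded T)
    {D : (L : ℕ) → STDecoder (L + 1) (T L)}
    (hD : ∀ L, (D L).IsMinWeight (stSyn (L + 1) (T L)) (stCycles (L + 1) (T L)) hammingNorm)
    {p : ℝ} (hp₀ : 0 ≤ p) (hpp : p < thresholdValue (4865 / 1000)) :
    DecaysExponentially (phenomFailureFamily T D) p :=
  PhenomCluster.phenom_decaysExponentially_sawCountBound3 phenomFailureProb_le_of_sawCountBound_holds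
    (by norm_num) sawCountBound3_memFour hT hD hp₀ hpp

/-! ### Instance 2 (tier = that of the `μ(ℤ³)` bound), unconditional in the threshold fact -/

/-- **Phenomenological toric threshold from any bound on the cubic connective constant,
UNCONDITIONAL** in the threshold fact: if `μ(ℤ³) ≤ μ'` with `μ' ≥ 1` (any proved bound, its tier),
then `p₀(μ')` is a threshold lower bound for every polynomially bounded schedule and every
minimum-weight space-time decoder family. [cite: DennisEtAl2002, §5.3 eqs. (saw_3), (threshold_iso)] -/
theorem phenomThreshold_connectiveConstant_three_le {μ' : ℝ} (hμ'1 : 1 ≤ μ')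
    (hμ : SAW.Zd.connectiveConstant 3 ≤ μ') {T : ℕ → ℕ} (hT : IsPolyBounded T)
    {D : (L : ℕ) → STDecoder (L + 1) (T L)}
    (hD : ∀ L, (D L).IsMinWeight (stSyn (L + 1) (T L)) (stCycles (L + 1) (T L)) hammingNorm) :
    IsThresholdLowerBound (phenomFailureFamily T D) (thresholdValue μ') :=
  phenomThreshold_of_connectiveConstant_three_le phenomThreshold_of_sawCountBound_holds hμ'1 hμ hT hD

/-- **`p_c ≥ p₀(μ(ℤ³))`-type corollary in symbolic form**: for every `μ' ≥ max(1, μ(ℤ³))`,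
`p₀(μ') ≤ p_c` — UNCONDITIONAL in the threshold fact. [cite: DennisEtAl2002, §5.3 eq. (threshold_iso_num)] -/
theorem phenom_thresholdValue_le_accuracyThreshold_of_connectiveConstant_le {μ' : ℝ} (hμ'1 : 1 ≤ μ')
    (hμ : SAW.Zd.connectiveConstant 3 ≤ μ') {T : ℕ → ℕ} (hT : IsPolyBounded T)
    {D : (L : ℕ) → STDecoder (L + 1) (T L)}
    (hD : ∀ L, (D L).IsMinWeight (stSyn (L + 1) (T L)) (stCycles (L + 1) (T L)) hammingNorm) :
    thresholdValue μ' ≤ accuracyThreshold (phenomFailureFamily T D) :=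
  le_accuracyThreshold (phenomThreshold_connectiveConstant_three_le hμ'1 hμ hT hD)
    ((thresholdValue_le_half _).trans (by norm_num))

/-! ### Instance 3 (tier CERTIFIED-conditional on the Pönitz–Tittmann fact ONLY): `p₀(4.7387) > .0112` -/

/-- **Phenomenological toric threshold `> .0112`, conditional ONLY on the Pönitz–Tittmann named fact
`SAW.Zd.PT2000_connectiveConstant_three_le`** (`μ(ℤ³) ≤ 4.7387`): `p₀(4.7387)` is a threshold lower
bound for every polynomially bounded schedule and every minimum-weight space-time decoder family.
(DKLP's printed `.0114` would need `μ₃ ≤ 4.684`, a numerical estimate — CLAIM, not typed.)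
[cite: DennisEtAl2002, §5.3 eqs. (saw_3), (threshold_iso_num)] -/
theorem phenomThreshold_PT2000_of_fact (hμ : SAW.Zd.PT2000_connectiveConstant_three_le)
    {T : ℕ → ℕ} (hT : IsPolyBounded T) {D : (L : ℕ) → STDecoder (L + 1) (T L)}
    (hD : ∀ L, (D L).IsMinWeight (stSyn (L + 1) (T L)) (stCycles (L + 1) (T L)) hammingNorm) :
    IsThresholdLowerBound (phenomFailureFamily T D) (thresholdValue 4.7387) :=
  phenomThreshold_PT2000 phenomThreshold_of_sawCountBound_holds hμ hT hD

/-- **`p_c > .0112`**, conditional ONLY on `SAW.Zd.PT2000_connectiveConstant_three_le`.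
[cite: DennisEtAl2002, §5.3 eqs. (saw_3), (threshold_iso_num)] -/
theorem phenom_accuracyThreshold_gt_PT2000_of_fact (hμ : SAW.Zd.PT2000_connectiveConstant_three_le)
    {T : ℕ → ℕ} (hT : IsPolyBounded T) {D : (L : ℕ) → STDecoder (L + 1) (T L)}
    (hD : ∀ L, (D L).IsMinWeight (stSyn (L + 1) (T L)) (stCycles (L + 1) (T L)) hammingNorm) :
    (0.0112 : ℝ) < accuracyThreshold (phenomFailureFamily T D) :=
  phenom_accuracyThreshold_gt_PT2000 phenomThreshold_of_sawCountBound_holds hμ hT hD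

/-! ### Exponential decay below threshold (DKLP route), unconditional -/

/-- **Exponential decay below `p₀(ν)`, DKLP route, UNCONDITIONAL**: under `cₙ(ℤ³) ≤ C νⁿ`
(`ν ≥ 1`), for every polynomially bounded schedule and every minimum-weight space-time decoder
family, the failure probability decays exponentially in `L` at every `0 ≤ p < p₀(ν)` (the finite-size
named fact is discharged by `ToricCode.phenomFailureProb_le_of_sawCountBound_holds`).
[cite: DennisEtAl2002, §5.3 eq. (fail_iso) and the sentence after it] -/
theorem phenom_decaysExponentially_sawCountBound3' {C ν : ℝ} (hν : 1 ≤ ν) (hc : SAWCountBound3 C ν)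
    {T : ℕ → ℕ} (hT : IsPolyBounded T) {D : (L : ℕ) → STDecoder (L + 1) (T L)}
    (hD : ∀ L, (D L).IsMinWeight (stSyn (L + 1) (T L)) (stCycles (L + 1) (T L)) hammingNorm)
    {p : ℝ} (hp₀ : 0 ≤ p) (hpp : p < thresholdValue ν) :
    DecaysExponentially (phenomFailureFamily T D) p :=
  PhenomCluster.phenom_decaysExponentially_sawCountBound3 phenomFailureProb_le_of_sawCountBound_holds
    hν hc hT hD hp₀ hpp

end Summit.Ventures.QEC.Thresholds

end
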